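import Mathlib.CategoryTheory.Conj
import Mathlib.CategoryTheory.Equivalence
import Mathlib.CategoryTheory.MorphismProperty.Basic
import Mathlib.Algebra.Group.Subgroup.Basic
import Mathlib.Algebra.Group.Subgroup.Map
import Mathlib.Algebra.Group.Subgroup.Lattice
import Mathlib.GroupTheory.QuotientGroup.Defs
import Mathlib.GroupTheory.Index
import Mathlib.Topology.Algebra.Group.Basic
import Mathlib.Data.ZMod.Basic
import Mathlib.Data.PNat.Basic
import Mathlib.SetTheory.Cardinal.Finite
import Literature.AlgebraicGeometry.Frobenioids.PreFrobenioidData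
import Literature.AnabelianGeometry.EtaleTheta.SectionTorsionSubgroup

/-!
# [EtTh] §5: the Frobenioid-theoretic theta setting (pp. 322–333 / PDF pp. 96–107)

Mochizuki, *The étale theta function and its Frobenioid-theoretic manifestations*, Publ. RIMS **45**
(2009) 227–349 [cite: MochizukiEtTh2009, §5 p.322 (PDF p.96)], §5 "The Étale Theta Function via Tempered
Frobenioids".  Layer L2 of the abc-iut cell, seat abc-iut-L2-t4; locators give the printed page
and, in parentheses, the PDF page of `paper:doi-10-2977-prims-1234361159`.

**What §5 is about.**  One "returns to the situation of Example 3.9" (p. 322): for one of the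
orbicurves `X̲, C̲, X̳, C̳, Ẋ̲, Ċ̲, Ẋ̳, Ċ̳` of Def. 2.5 (odd `l ≥ 1`, base field `K = K̈`), the divisor
monoid `Φ = Φ^ell` on `D` "determines a tempered Frobenioid `C` of monoid type `ℤ` over the base
category `D`"; one fixes a self-equivalence `Ψ : C ⥲ C`, an integer `N ≥ 1`, the Frobenius-trivial
object `A_⊚` "defined by the trivial line bundle over `Ÿ̲^log`", and — from the sections `s_{l·N}`,
`τ_{l·N}` of §1 — a pair of base-equivalent morphisms `s^⊓_N, s^⊔_N : A_N → B_N` of `C` (pp. 323,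
330), the bi-Kummer data `s^trv_N, s^⊓-gp_N, s^⊔-gp_N` (p. 331), the subgroup
`E_N := s^⊓-gp_N(Im(Π^tp_Y̲)) · μ_N(B_N) ⊆ Aut_C(B_N)` and `E^Π_N := E_N ×_{Im(Π^tp_Y̲)} Π^tp_Y̲`
(p. 332), out of which Theorem 5.10 extracts a mono-theta environment.

**How it is typed (STATEMENTS-FIRST; plan/L2/ASSIGNMENTS.md §C.4).**  The Frobenioid-level
operations `(Base, Div, deg_Fr)` and the [FrdI] Def. 1.2 typology (`unitsSubgroup = O^×(−)`,
`IsLinear`, `IsIsometry`, `IsPreStep`, `IsFrobeniusTrivial`, `IsAutAmple`, …) are the TREE's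
`Literature.AlgebraicGeometry.Frobenioids.PreFrobenioidData`; what does not exist in the tree yet —
the Frobenioid axioms of Def. 1.3 (abc-iut-found), tempered Frobenioids / birationalization /
bi-Kummer theory ([EtTh] §3–4, abc-iut-L2-t3), the curves and theta quotients of §2 (abc-iut-L2-t2),
the tempered `π₁` (abc-iut-L3-t2) — is carried as DATA:
* `FrobenioidTheta.TemperedFrobenioidStub` — a `PreFrobenioidData` `pre` together with the extra
  §4/§5 vocabulary `TODO-merge(abc-iut-found, abc-iut-L2-t3)`: commutativity of `O^×(S)` ([FrdI]
  Rmk. 1.3.1), the units `O^×(S^birat)` of the birationalization with `O^×(S) ↪ O^×(S^birat)` and the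
  pull-back of units along morphisms, and the class of morphisms of base-Frobenius type ([EtTh]
  Def. 4.1 (iv));
* `FrobenioidTheta.ThetaSubquotientStub` — `TODO-merge(abc-iut-L2-t2)`: the characteristic
  subquotients `(l·Δ_Θ)_E` of `Aut_D(E)` (p. 327, from Props. 2.4, 2.6) as abelian groups with
  their transport along morphisms of `D`;
* `ThetaFrobenioid` — the §5 data proper over these: `l, N, A_⊚, A_N, B_N, s^⊓_N, s^⊔_N`, the
  tempered groups `Π^tp_X̲ ⊇ Π^tp_Y̲ ⊇ Π^tp_Ÿ̲` with `Π^tp_X̲/Π^tp_Y̲ ≅ l·ℤ` (Lemma 5.9 (iii)) and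
  `[Π^tp_Y̲ : Π^tp_Ÿ̲] = 2` (proof of Thm. 5.10 (iii)), a representative `ρ` of the natural surjective
  outer homomorphism `Π^tp_X̲ ↠ Aut_D(B_N^bs)` (Def. 4.1 (ii)), the sections `s^trv_N, s^⊓-gp_N,
  s^⊔-gp_N`, the constants `K^× ↪ O^×(B_N^birat)`, and the theta function `Θ̈ ∈ O^×(A_⊚^birat)`.
  Fields that are `Prop`s transcribe printed sentences with page; NOTHING asserts that such data
  exist (that is the content of §1–§4 and of [SemiAnbd]/[André]); every §5 statement (sibling files
  `FrobenioidThetaBiKummer.lean`, `FrobenioidMonoTheta.lean`, `ConstantMultipleIndeterminacy.lean`)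
  is a predicate on `ThetaFrobenioid`.
REAL definitions here: `μ_M(S)` = the tree's `nTorsionIn (O^×(S))` ([FrdII] Def. 2.1 (i)), `μ_M`-saturation,
`(l·Δ_Θ)_S ⊗ ℤ/Nℤ`, Def. 5.4 `IsThetaSaturated`, `Im(Π^tp_Y̲)`, `H_{B_N}`, `E_N` = the tree's `sectionSubgroup` (so the
proved Lemma 5.9 (i)–(iii) of `SectionTorsionSubgroup.lean` apply definitionally); PROVED: `O^×(S) = Ker(Aut_C(S) →
Aut_D(S^bs))`.  `E^Π_N`, `ϵ`, the constants of Lemma 5.8 and `Aut_D(A_N^bs) ⥲ Aut_D(B_N^bs)` are in the sibling files;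
the "evident topologies" (p. 332) are put on `E^Π_N` in `FrobenioidMonoThetaEnv.lean` (`Aut_C(B_N)` discrete).
Universes are independent as in `PreFrobenioidData` (`C : Type u`/`Category.{v}`, `D : Type u'`/`Category.{v'}`;
monoids, birational units, `(l·Δ_Θ)_E`, `K` in `Type w`; `Π^tp` in `Type v`), so that the tree's model Frobenioid can
instantiate the data (abc-iut-L2-t9's adapter `TemperedFrobenioidStub.ofModel`).
HONEST FRAMING: [EtTh] is a refereed paper; nothing in it is asserted here; typed ≠ proved; no side is
taken on any disputed claim downstream.

v4 (docstring-only patch, filed by abc-iut-L6-t23 under the L2 succession rule for abc-iut-L2-t4; no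
signature, body or name changed): referee findings D2-F5 (`HB` is the printed `H_{B_N^bs}`, identified with
`H_{B_N}` by `H`-ampleness — reading recorded on `HB`) and D2-F6 (`zquot` auxiliary locator p.267 (PDF p.41)).
-/

namespace Literature.AnabelianGeometry.EtaleTheta

open CategoryTheory

universe w v v' u u'

namespace FrobenioidTheta

/-- **LOCAL STUB — `TODO-merge(abc-iut-found, abc-iut-L2-t3)`.**  "The tempered Frobenioid `C` of
monoid type `ℤ` over the base category `D`" of [EtTh] §5 (p.322 (PDF p.96); Example 3.9, Def. 3.6),
through exactly what the STATEMENTS of §5 mention: the tree's `PreFrobenioidData` (`pre`: `Base`,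
`Div`, `deg_Fr` with the laws of [FrdI] Rmk. 1.1.1, whence `pre.unitsSubgroup S = O^×(S)`,
`pre.IsLinear`, `pre.IsIsometry`, `pre.IsPreStep`, `pre.IsFrobeniusTrivial`, `pre.IsAutAmple`, …)
plus the §4/§5 extras the tree does not have yet.  Owner decls on merge: abc-iut-found's Def. 1.3
files (the Frobenioid axioms making `C` a tempered Frobenioid) and abc-iut-L2-t3's `BiKummerSetting`
(`biratUnits`, `IsOfBaseFrobeniusType`, …; HOME/staging/L2/L2-t3/BiKummer.lean).
[cite: MochizukiEtTh2009, §5 p.322 (PDF p.96)] -/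
structure TemperedFrobenioidStub (C : Type u) [Category.{v} C] (D : Type u') [Category.{v'} D] where
  /-- the operations `(Base, Div, deg_Fr)` of the Frobenioid `C → D` ([FrdI] Def. 1.1 (iv)); `S^bs`
  is `pre.base.obj S` ("we shall use the superscript 'bs' to denote the object or arrow determined
  by a given object or arrow of `C` in the base category `D`", §4 p.312 (PDF p.86)). -/
  pre : Literature.AlgebraicGeometry.Frobenioids.PreFrobenioidData.{w} C D
  /-- `O^×(S)` is abelian: "since `O^▷(A)` is abelian [cf. [FrdI], Remark 1.3.1]" ([FrdII]
  Def. 2.1 (i)). -/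
  units_comm : ∀ S : C, IsMulCommutative (pre.unitsSubgroup S)
  /-- `O^×(S^birat)`, the units of the image of `S` "in the birationalization `C^birat`
  [cf. [FrdI], Proposition 4.4]" (§4 p.312 (PDF p.86); p.331 (PDF p.105) "`O^×(B_N^birat)`"), an
  abelian group. -/
  biratUnits : C → Type w
  [instCommGroupBirat : ∀ S, CommGroup (biratUnits S)]
  /-- `O^×(S) → O^×(S^birat)`, "the natural inclusion" (p.331 (PDF p.105): `(O_K^×)^{1/N} :=
  (K^×)^{1/N} ∩ O^×(B_N)` is formed inside `O^×(B_N^birat)`). -/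
  unitsToBirat : ∀ S : C, pre.unitsSubgroup S →* biratUnits S
  /-- `O^×(S) ↪ O^×(S^birat)` is injective (an inclusion, p.331 (PDF p.105)). -/
  unitsToBirat_injective : ∀ S, Function.Injective (unitsToBirat S)
  /-- Pull-back of units along a morphism `φ : S → T`: `O^×(T) → O^×(S)` (used for the
  functoriality "with respect to … linear morphisms" of Prop. 5.5, pp.327–328 (PDF pp.101–102):
  linear morphisms `S'' → S` "induce isomorphisms … `μ_N(S) ⥲ μ_N(S'')`"). -/
  unitsPull : ∀ {S T : C}, (S ⟶ T) → (pre.unitsSubgroup T →* pre.unitsSubgroup S)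
  /-- morphisms "of base-Frobenius type" ([EtTh] Def. 4.1 (iv), p.313 (PDF p.87); abc-iut-L2-t3's
  `IsOfBaseFrobeniusType`). -/
  IsBaseFrobeniusType : MorphismProperty C

attribute [instance] TemperedFrobenioidStub.units_comm TemperedFrobenioidStub.instCommGroupBirat

/-- **LOCAL STUB — `TODO-merge(abc-iut-L2-t2)`.**  The characteristic subquotients of §5 p.327 (PDF p.101):
"recall the characteristic [cf. Propositions 2.4, 2.6] subquotients `Π^tp_X ↠ (Π^tp_X)^Θ`;
`l·Δ_Θ ⊆ (Π^tp_X)^Θ` … Thus, for `D ∈ Ob(D)`, these subquotients determine subquotients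
`Aut_D(D) ↠ Aut^Θ_D(D)`; `(l·Δ_Θ)_D ⊆ Aut^Θ_D(D)` which are preserved by arbitrary
self-equivalences of `D`".  Carried as: for each object `E` of `D` an abelian group `(l·Δ_Θ)_E`
(a subquotient of the cyclic-by-… group `Aut_D(E)`; `Δ_Θ ≅ Ẑ(1)` is abelian, p.238 (PDF p.12)) together with
its covariant transport along morphisms of `D`.  Owner: abc-iut-L2-t2 (Def. 2.1/2.3/2.5, Props.
2.4/2.6 over abc-iut-L3-t2's `OncePuncturedTemperedGroup`).
[cite: MochizukiEtTh2009, §5 p.327 (PDF p.101)] -/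
structure ThetaSubquotientStub (D : Type u') [Category.{v'} D] where
  /-- `(l·Δ_Θ)_E ⊆ Aut^Θ_D(E)`, the subquotient of `Aut_D(E)` cut out by `l·Δ_Θ ⊆ (Π^tp_X)^Θ`
  (p.327 (PDF p.101)), as an abstract abelian group. -/
  lDelta : D → Type w
  [instCommGroupLDelta : ∀ E, CommGroup (lDelta E)]
  /-- transport of `(l·Δ_Θ)_{(-)}` along a morphism `E → E'` of `D` (a morphism of connected
  tempered coverings induces a map on the subquotients of their Galois groups; used for the
  functoriality clause of Prop. 5.5, p.327 (PDF p.101)–328). -/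
  lDeltaMap : ∀ {E E' : D}, (E ⟶ E') → (lDelta E →* lDelta E')

attribute [instance] ThetaSubquotientStub.instCommGroupLDelta

end FrobenioidTheta

open FrobenioidTheta

/-- **The [EtTh] §5 Frobenioid-theoretic theta setting** (pp. 322–323, 330–333): the tempered
Frobenioid `C → D` of Example 3.9 for one of the curves of Def. 2.5 (stub fields), "for some odd
integer `l ≥ 1`", "`N ≥ 1` an integer", the object `A_⊚` "defined by the trivial line bundle over
the object `Ÿ̲^log`" (p.322 (PDF p.96)), the pair "`s^⊓_N, s^⊔_N : A_N → B_N` … of base-equivalent morphisms of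
`C` determined by the sections `s_{l·N}`, `τ_{l·N}`" (p.330 (PDF p.104)), the tempered fundamental groups
`Π^tp_X̲ ⊇ Π^tp_Y̲ ⊇ Π^tp_Ÿ̲` entering Lemma 5.9 / Theorem 5.10 (from Thm. 5.10 on "`A` arises from
`X̲^log`", p.330 (PDF p.104)), a representative `ρ` of "the natural [surjective] outer homomorphism
`Π^tp_X ↠ Aut_D(B_N^bs)` [cf. Definition 4.1, (ii)]" (p.331 (PDF p.105)), the homomorphisms `s^trv_N`,
`s^⊓-gp_N`, `s^⊔-gp_N` (p.331 (PDF p.105)), the constants `K^× ↪ O^×(B_N^birat)` (p.331 (PDF p.105)), the subquotients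
`(l·Δ_Θ)_E` (stub), and `Θ̈`, "the Frobenioid-theoretic version of the log-meromorphic function
constituted by the theta function" (p.324 (PDF p.98)), as an element of `O^×(A_⊚^birat)`.  DATA ONLY: no field
asserts a result of §5.  [cite: MochizukiEtTh2009, §5 p.322–333 (PDF pp.96–107)] -/
structure ThetaFrobenioid (C : Type u) [Category.{v} C] (D : Type u') [Category.{v'} D]
    extends TemperedFrobenioidStub.{w} C D, ThetaSubquotientStub.{w} D where
  /-- "for some odd integer `l ≥ 1`" (p.322 (PDF p.96)). -/
  l : ℕ
  /-- `l` is odd (hence `≥ 1`) (p.322 (PDF p.96)). -/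
  odd_l : Odd l
  /-- "`N ≥ 1` an integer" (p.323 (PDF p.97)). -/
  N : ℕ+
  /-- `A_⊚`, "the [Frobenius-trivial] object defined by the trivial line bundle over the object
  `Ÿ̲^log`" (single underline case; `Ÿ̳^log` in the double underline case) (p.322 (PDF p.96)). -/
  Acirc : C
  /-- `A_N`, the `N`-domain of the root `s^⊓_N, s^⊔_N` (p.330 (PDF p.104); Prop. 4.2 (iii)). -/
  AN : C
  /-- `B_N`, the `N`-codomain of the root `s^⊓_N, s^⊔_N` (p.330 (PDF p.104); Prop. 4.2 (iii)). -/
  BN : C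
  /-- `s^⊓_N : A_N → B_N`, the morphism of `C` "determined by" the pull-back to `Z̈_{l·N}` of "the
  section `s_{l·N} ∈ Γ(Z_{l·N}, L_{l·N}|_{Z_{l·N}})` of Proposition 1.1, (i)" (pp.323, 330). -/
  sCap : AN ⟶ BN
  /-- `s^⊔_N : A_N → B_N`, the morphism of `C` "determined by" the pull-back of "the theta
  trivialization `τ_{l·N} ∈ Γ(Ÿ_{l·N}, L̈_{l·N})` of Lemma 1.2" (pp.323, 330). -/
  sCup : AN ⟶ BN
  /-- `s^⊓_N, s^⊔_N` are "base-equivalent" (p.330 (PDF p.104)): they induce the same arrow `A_N^bs → B_N^bs`. -/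
  base_map_sCap : pre.base.map sCap = pre.base.map sCup
  /-- `s^⊓_N` is a pre-step — "`s_N, s'_N : A_N → B_N` are base-equivalent pre-steps" (Prop. 4.2
  (iii), p.314 (PDF p.88)) — i.e. a linear base-isomorphism ([FrdI] Def. 1.2 (iii)). -/
  isPreStep_sCap : pre.IsPreStep sCap
  /-- `s^⊔_N` is a pre-step (Prop. 4.2 (iii), p.314 (PDF p.88)). -/
  isPreStep_sCup : pre.IsPreStep sCup
  /-- `Π^tp_X̲`, the tempered fundamental group of `X̲^log` (p.330 (PDF p.104) "`A` arises from `X̲^log`"; §1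
  p.237 (PDF p.11), Def. 2.1), a topological group.  `TODO-merge(abc-iut-L2-t2 / abc-iut-L3-t2)`. -/
  PiX : Type v
  [instGroupPiX : Group PiX]
  [instTopPiX : TopologicalSpace PiX]
  [instTopGroupPiX : IsTopologicalGroup PiX]
  /-- `Π^tp_X̲ ↠ Π^tp_X̲/Π^tp_Y̲ ≅ l·ℤ` (Lemma 5.9 (iii), p.332 (PDF p.106): "`l·ℤ ⥲ Π^tp_X/Π^tp_Y`"; p.267 (PDF p.41):
  "`Π^tp_Ẋ/Π^tp_Ÿ ≅ Π^tp_Ẋ̲/Π^tp_Ÿ̲ ≅ l·ℤ`"), valued in `ℤ` (the abstract group `l·ℤ`). (v4: auxiliary locator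
  corrected, referee finding D2-F6 — v3 cited p.264 (PDF p.38), which is Def. 2.3/Rmk. 2.3.1.) -/
  zquot : PiX →* Multiplicative ℤ
  /-- `Π^tp_X̲ → l·ℤ` is surjective (p.332 (PDF p.106)). -/
  zquot_surjective : Function.Surjective zquot
  /-- `Π^tp_Ÿ̲ ⊆ Π^tp_X̲`, the tempered fundamental group of the double covering `Ÿ̲ → Y̲`
  (p.322 (PDF p.96) "`Ÿ̲^log` of the discussion preceding Definition 2.7"; p.332 (PDF p.106) "`Π^tp_Ÿ̲`"). -/
  PiYdd : Subgroup PiX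
  /-- `Π^tp_Ÿ̲ ⊆ Π^tp_Y̲ = Ker(Π^tp_X̲ ↠ l·ℤ)` (p.332 (PDF p.106)). -/
  PiYdd_le : PiYdd ≤ zquot.ker
  /-- "Since `[Π^tp_Y : Π^tp_Ÿ] = 2`" (proof of Thm. 5.10 (iii), p.335 (PDF p.109)). -/
  relindex_PiYdd : PiYdd.relIndex zquot.ker = 2
  /-- `Π^tp_Ÿ̲` is normal in `Π^tp_X̲` (`A_⊚^bs` "is 'characteristic' … hence, in particular,
  Galois", p.322 (PDF p.96)–323; §4 p.312 (PDF p.86): "`A_⊚^bs` … Galois … determines normal open subgroups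
  `H ⊆ Π^tp_X`"). -/
  PiYdd_normal : PiYdd.Normal
  /-- `Π^tp_Ÿ̲` is open in `Π^tp_X̲` (§4 p.312 (PDF p.86) "normal open subgroups"). -/
  isOpen_PiYdd : IsOpen (PiYdd : Set PiX)
  /-- A representative of "the natural [surjective] outer homomorphism `Π^tp_X ↠ Aut_D(B_N^bs)`
  [cf. Definition 4.1, (ii)]" (p.331 (PDF p.105); `B_N` is Galois), chosen in its conjugacy class. -/
  ρ : PiX →* Aut (pre.base.obj BN)
  /-- `Π^tp_X ↠ Aut_D(B_N^bs)` is surjective (Def. 4.1 (ii), p.313 (PDF p.87)). -/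
  ρ_surjective : Function.Surjective ρ
  /-- `Ker(ρ)` is open: `B_N^bs` is a Galois object of the connected temperoid `D`, so `ρ` is the
  quotient by a normal OPEN subgroup (§4 p.312 (PDF p.86)), i.e. `ρ` is continuous for the discrete
  topology on `Aut_D(B_N^bs)` (needed for the "evident topology" of Lemma 5.9 (iv); abc-iut-L2-t11
  finding F1). -/
  isOpen_ker_ρ : IsOpen (ρ.ker : Set PiX)
  /-- `s^trv_N : Aut_D(A_N^bs) → Aut_C(A_N)`, "the group homomorphism … arising from a
  base-Frobenius pair of `A_N` [cf. Proposition 5.1; Theorem 3.7, (i); [FrdI], Proposition 5.6],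
  which is completely determined … up to conjugation by an element of `O^×(A_N)`" (pp.330–331 (PDF pp.104–105)). -/
  strv : Aut (pre.base.obj AN) →* Aut AN
  /-- `s^⊓-gp_N : Aut_D(B_N^bs) → Aut_C(B_N)` (p.331 (PDF p.105)), the first of the "unique group
  homomorphisms" of the bi-Kummer root (Prop. 4.3 (i); its defining relation is the named fact
  `ThetaFrobenioid.SgpCapSpec` of `FrobenioidMonoTheta.lean`). -/
  sgpCap : Aut (pre.base.obj BN) →* Aut BN
  /-- `s^⊔-gp_N : H_{B_N} → Aut_C(B_N)` (p.331 (PDF p.105)), the second homomorphism of the bi-Kummer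
  root.  In Def. 4.1 (ii) `H_{B_N}` is the INVERSE image in `Aut_C(B_N)/O^×(B_N)` of the image
  `H_{B_N^bs} ⊆ Aut_D(B_N^bs)` of `H = Π^tp_Ÿ̲`; the two are identified because "`B_N` is Aut-ample"
  (p.330 (PDF p.104)), so we let `s^⊔-gp_N` be defined on the image `ρ(Π^tp_Ÿ̲) ⊆ Aut_D(B_N^bs)`. -/
  sgpCup : PiYdd.map ρ →* Aut BN
  /-- "`K` a finite extension of `ℚ_p`" (§1 p.237 (PDF p.11)), here with `K = K̈` (p.322 (PDF p.96)); enters §5 only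
  through its multiplicative group. -/
  K : Type w
  [instFieldK : Field K]
  /-- "the natural inclusion `K^× ↪ O^×(B_N^birat)`" (Lemma 5.8, p.331 (PDF p.105)). -/
  constEmb : Kˣ →* biratUnits BN
  /-- `K^× ↪ O^×(B_N^birat)` is injective (an inclusion, p.331 (PDF p.105)). -/
  constEmb_injective : Function.Injective constEmb
  /-- `Θ̈`: "[the Frobenioid-theoretic version of the log-meromorphic function constituted by] the
  theta function `Θ̈` of Proposition 1.4" (p.324 (PDF p.98)), an element of `O^×(A_⊚^birat)` (Def. 4.1 (i):
  fraction-pairs are taken "for `f ∈ O^×(A^birat)`"). -/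
  thetaFn : biratUnits Acirc

attribute [instance] ThetaFrobenioid.instGroupPiX ThetaFrobenioid.instTopPiX
  ThetaFrobenioid.instTopGroupPiX ThetaFrobenioid.instFieldK

namespace ThetaFrobenioid

variable {C : Type u} [Category.{v} C] {D : Type u'} [Category.{v'} D] (𝔉 : ThetaFrobenioid.{w} C D)

/-! ### The Frobenioid-level vocabulary, read off the tree's `PreFrobenioidData` -/

/-- `S ↦ S^bs`, the base functor `C → D` ([FrdI] Def. 1.1 (iv); §4 p.312 (PDF p.86)).
[cite: MochizukiEtTh2009, §4 p.312 (PDF p.86)] -/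
abbrev base : C ⥤ D := 𝔉.pre.base

/-- `O^×(S) ⊆ Aut_C(S)`, the base-identity linear automorphisms ([FrdI] Def. 1.2 (ii); the tree's
`PreFrobenioidData.unitsSubgroup`; p.331 (PDF p.105) "`O^×(B_N)`").
[cite: MochizukiEtTh2009, §5 p.331 (PDF p.105)] -/
abbrev units (S : C) : Subgroup (Aut S) := 𝔉.pre.unitsSubgroup S

/-- linear morphisms, `deg_Fr = 1` ([FrdI] Def. 1.2 (i); tree `PreFrobenioidData.IsLinear`).
[cite: MochizukiEtTh2009, Prop 5.5 p.327 (PDF p.101)] -/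
abbrev IsLinear : MorphismProperty C := 𝔉.pre.IsLinear

/-- isometries, `Div = 0` ([FrdI] Def. 1.2 (i); tree `PreFrobenioidData.IsIsometry`).
[cite: MochizukiEtTh2009, Cor 5.12 p.339 (PDF p.113)] -/
abbrev IsIsometry : MorphismProperty C := 𝔉.pre.IsIsometry

/-- pre-steps, linear base-isomorphisms ([FrdI] Def. 1.2 (iii); tree `PreFrobenioidData.IsPreStep`).
[cite: MochizukiEtTh2009, Prop 4.2 (iii) p.314 (PDF p.88)] -/
abbrev IsPreStep : MorphismProperty C := 𝔉.pre.IsPreStep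

/-- the Frobenius degree `deg_Fr` ([FrdI] Def. 1.1 (iii); tree `PreFrobenioidData.degFr`).
[cite: MochizukiEtTh2009, Cor 5.12 p.339 (PDF p.113)] -/
abbrev degFr {S T : C} (φ : S ⟶ T) : ℕ+ := 𝔉.pre.degFr φ

/-- Frobenius-trivial objects ([FrdI] Def. 1.2 (iv); tree `PreFrobenioidData.IsFrobeniusTrivial`;
p.322 (PDF p.96) "the [Frobenius-trivial] object defined by the trivial line bundle").
[cite: MochizukiEtTh2009, §5 p.322 (PDF p.96)] -/
abbrev IsFrobeniusTrivial (S : C) : Prop := 𝔉.pre.IsFrobeniusTrivial S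

/-- Aut-ample objects: `Aut_C(A) → Aut_D(A^bs)` surjective ([FrdI] Def. 1.2 (iv); tree
`PreFrobenioidData.IsAutAmple`; p.330 (PDF p.104) "it follows that `B_N` is Aut-ample").
[cite: MochizukiEtTh2009, §5 p.330 (PDF p.104)] -/
abbrev IsAutAmple (S : C) : Prop := 𝔉.pre.IsAutAmple S

/-- `Aut_C(S) → Aut_D(S^bs)`, `β ↦ β^bs` (the base functor on automorphisms; p.331 (PDF p.105)).
[cite: MochizukiEtTh2009, §5 p.331 (PDF p.105)] -/
abbrev autBase (S : C) : Aut S →* Aut (𝔉.base.obj S) := 𝔉.base.mapAut S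

/-- Elements of `O^×(S)` are base-identity: `Base(u) = id` ([FrdI] Def. 1.2 (ii)) — by definition of
the tree's `unitsSubgroup`.  [cite: MochizukiEtTh2009, §5 p.331 (PDF p.105)] -/
theorem base_map_units (S : C) (u : Aut S) (hu : u ∈ 𝔉.units S) :
    𝔉.base.map u.hom = 𝟙 (𝔉.base.obj S) := hu.1

/-- Automorphisms are linear: `deg_Fr(α) = 1` for `α ∈ Aut_C(S)` (degrees are multiplicative and
`deg_Fr(id) = 1`, [FrdI] Rmk. 1.1.1).  [cite: MochizukiEtTh2009, §5 p.330 (PDF p.104)] -/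
theorem isLinear_of_aut {S : C} (α : Aut S) : 𝔉.IsLinear α.hom := by
  have h := 𝔉.pre.degFr_comp α.hom α.inv
  rw [α.hom_inv_id, 𝔉.pre.degFr_id] at h
  have h' : ((𝔉.pre.degFr α.hom : ℕ+) : ℕ) * (𝔉.pre.degFr α.inv : ℕ) = 1 := by
    exact_mod_cast h.symm
  exact PNat.coe_injective (Nat.eq_one_of_mul_eq_one_right h')

/-- **`O^×(S) = Ker(Aut_C(S) → Aut_D(S^bs))`** — PROVED from the [FrdI] laws: a base-identity
automorphism is automatically linear.  (With Aut-ampleness this is the exact sequence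
"`1 → O^×(−) → Aut_C((−)) → Aut_D((−)^bs) → 1`" of Rmk. 5.12.5 (iii), p.345 (PDF p.119).)
[cite: MochizukiEtTh2009, Rmk 5.12.5 (iii) p.345 (PDF p.119)] -/
theorem units_eq_ker (S : C) : 𝔉.units S = (𝔉.autBase S).ker := by
  ext α
  rw [MonoidHom.mem_ker]
  constructor
  · intro h
    exact Aut.ext h.1
  · intro h
    exact ⟨congrArg Iso.hom h, 𝔉.isLinear_of_aut α⟩

/-- `O^×(S)` is normal in `Aut_C(S)` (it is a kernel). [cite: MochizukiEtTh2009, §5 p.331 (PDF p.105)] -/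
theorem units_normal (S : C) : (𝔉.units S).Normal := by
  rw [units_eq_ker]; infer_instance

/-! ### Cyclotomes and saturation ([FrdII] Def. 2.1 (i); [EtTh] Def. 5.4) -/

/-- `μ_M(S) ⊆ O^×(S) ⊆ Aut_C(S)`: "the subgroup of elements of `O^×(A)` that are annihilated by
`M`" ([FrdII] Def. 2.1 (i)), "the cyclotomic portion of `O^×(A)` of order `M`"; p.327 (PDF p.101)
"`μ_N(S) (= l·μ_{l·N}(S))`".  The tree's `nTorsionIn` of the commutative subgroup `O^×(S)`.
[cite: MochizukiEtTh2009, Def 5.4 p.327 (PDF p.101)] -/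
abbrev muTorsion (S : C) (M : ℕ) : Subgroup (Aut S) :=
  nTorsionIn (𝔉.units S) (fun _ hx _ hy => setLike_mul_comm (s := 𝔉.units S) hx hy) M

/-- Membership in `μ_M(S)`. [cite: MochizukiEtTh2009, Def 5.4 p.327 (PDF p.101)] -/
@[simp]
theorem mem_muTorsion {S : C} {M : ℕ} {u : Aut S} :
    u ∈ 𝔉.muTorsion S M ↔ u ∈ 𝔉.units S ∧ u ^ M = 1 := Iff.rfl

/-- `μ_M(S) ⊆ O^×(S)`. [cite: MochizukiEtTh2009, Def 5.4 p.327 (PDF p.101)] -/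
theorem muTorsion_le_units (S : C) (M : ℕ) : 𝔉.muTorsion S M ≤ 𝔉.units S := fun _ h => h.1

/-- `μ_M(S)` is normal in `Aut_C(S)` (characteristic in the normal subgroup `O^×(S)`).
[cite: MochizukiEtTh2009, §5 p.331 (PDF p.105)] -/
theorem muTorsion_normal (S : C) (M : ℕ) : (𝔉.muTorsion S M).Normal :=
  haveI := 𝔉.units_normal S
  nTorsionIn_normal _ _ M

/-- `μ_M(S) ⊆ Ker(Aut_C(S) → Aut_D(S^bs))`. [cite: MochizukiEtTh2009, §5 p.331 (PDF p.105)] -/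
theorem muTorsion_le_ker (S : C) (M : ℕ) : 𝔉.muTorsion S M ≤ (𝔉.autBase S).ker :=
  (𝔉.muTorsion_le_units S M).trans (𝔉.units_eq_ker S).le

/-- `S` is `μ_M`-saturated: "if the abstract group `μ_M(A)` is isomorphic to `ℤ/Mℤ`" ([FrdII]
Def. 2.1 (i); used in Def. 5.4 (a): "`S` is `μ_{l·N}`-saturated [cf. [FrdII], Definition 2.1,
(i)]").  [cite: MochizukiEtTh2009, Def 5.4 p.327 (PDF p.101)] -/
def IsMuSaturated (S : C) (M : ℕ) : Prop :=
  Nonempty (𝔉.muTorsion S M ≃* Multiplicative (ZMod M))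

/-- `(l·Δ_Θ)_S := (l·Δ_Θ)_{S^bs}` for `S ∈ Ob(C)` (p.327 (PDF p.101): "If `S ∈ Ob(C)`, then we shall
write `(l·Δ_Θ)_S := (l·Δ_Θ)_{S^bs}`").  [cite: MochizukiEtTh2009, §5 p.327 (PDF p.101)] -/
abbrev lDeltaObj (S : C) : Type w := 𝔉.lDelta (𝔉.base.obj S)

/-- `(l·Δ_Θ)_S ⊗ ℤ/Nℤ` (Def. 5.4 (b), Prop. 5.5), for a multiplicatively written abelian group:
the quotient of `(l·Δ_Θ)_S` by `N`-th powers.  [cite: MochizukiEtTh2009, Def 5.4 p.327 (PDF p.101)] -/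
abbrev lDeltaModN (S : C) : Type w :=
  𝔉.lDeltaObj S ⧸ (powMonoidHom (𝔉.N : ℕ) : 𝔉.lDeltaObj S →* 𝔉.lDeltaObj S).range

/-- **[EtTh] Definition 5.4.**  "We shall say that `S ∈ Ob(C)` is `(l, N)`-theta-saturated if the
following conditions are satisfied: (a) `S` is `μ_{l·N}`-saturated [cf. [FrdII], Definition 2.1,
(i)]; (b) `(l·Δ_Θ)_S ⊗ ℤ/Nℤ` is of cardinality `N`."
[cite: MochizukiEtTh2009, Def 5.4 p.327 (PDF p.101)] -/
structure IsThetaSaturated (S : C) : Prop where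
  /-- (a) `S` is `μ_{l·N}`-saturated. -/
  muSaturated : 𝔉.IsMuSaturated S (𝔉.l * 𝔉.N)
  /-- (b) `(l·Δ_Θ)_S ⊗ ℤ/Nℤ` has cardinality `N`. -/
  card_lDeltaModN : Nat.card (𝔉.lDeltaModN S) = 𝔉.N

/-! ### The groups attached to `B_N` (pp. 330–333) -/

/-- `Π^tp_Y̲ := Ker(Π^tp_X̲ ↠ l·ℤ)` (p.332 (PDF p.106) "`Π^tp_Y ⊆ Π^tp_X`", "`l·ℤ ⥲ Π^tp_X/Π^tp_Y`").
[cite: MochizukiEtTh2009, Lem 5.9 (iii) p.332 (PDF p.106)] -/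
def PiY : Subgroup 𝔉.PiX := 𝔉.zquot.ker

/-- `Im(Π^tp_Y̲) ⊆ Aut_D(B_N^bs)`: "the image of `Π^tp_Y ⊆ Π^tp_X` via the natural outer
homomorphism `Π^tp_X ↠ Aut_D(B_N^bs)`" (pp.331–332 (PDF pp.105–106)), computed with the representative `ρ`.
[cite: MochizukiEtTh2009, Lem 5.9 (ii) p.332 (PDF p.106)] -/
def imPiY : Subgroup (Aut (𝔉.base.obj 𝔉.BN)) := 𝔉.PiY.map 𝔉.ρ

/-- `H_{B_N^bs} ⊆ Aut_D(B_N^bs)`: the image of `H = Π^tp_Ÿ̲` (the normal open subgroup determined by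
the Galois object `A_⊚^bs`, §4 p.312 (PDF p.86)) "via this surjection" `Π^tp_X ↠ Aut_D(B_N^bs)` — i.e. the
printed `H_{B_N^bs}`; it is identified with `H_{B_N} ⊆ Aut_C(B_N)/O^×(B_N)` (Def. 4.1 (ii), p.313 (PDF
p.87): `H_{B_N}` is the INVERSE image of `H_{B_N^bs}` in `Aut_C(B_N)/O^×(B_N)`) by the `H`-ampleness of `B_N`,
which is how `s^⊔-gp_N` (p.331, domain `H_{B_N}`) is typed on this subgroup.  The Lean name `HB` is kept
(consumers); v4 records the reading (referee finding D2-F5).  [cite: MochizukiEtTh2009, §5 p.331 (PDF p.105)] -/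
def HB : Subgroup (Aut (𝔉.base.obj 𝔉.BN)) := 𝔉.PiYdd.map 𝔉.ρ

/-- **`E_N`** `:= s^⊓-gp_N(Im(Π^tp_Y̲)) · μ_N(B_N) ⊆ Aut_C(B_N)` (p.331 (PDF p.105)): the tree's
`sectionSubgroup` (the join `s^⊓-gp_N(Im Π^tp_Y̲) ⊔ μ_N(B_N)`, equal to the printed product since
`μ_N(B_N)` is normal — `mem_sectionSubgroup_iff`; the PROVED Lemma 5.9 (i)–(iii) of
`SectionTorsionSubgroup.lean` apply to it definitionally).
[cite: MochizukiEtTh2009, §5 p.331 (PDF p.105)] -/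
abbrev EN : Subgroup (Aut 𝔉.BN) := sectionSubgroup 𝔉.sgpCap 𝔉.imPiY (𝔉.muTorsion 𝔉.BN 𝔉.N)

end ThetaFrobenioid

end Literature.AnabelianGeometry.EtaleTheta
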